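import Summits.ABC.IUTFork.LDHGenuineUnionPrintIsm
import Summits.ABC.IUTFork.LDHGenuinePerImagePrintIsmFrey283
import HarnessLib

/-!
# The fork at [IUTchIII] Corollary 3.12, L-DH level, READING (U) over PRINT's (Ind2): the RATIONAL witnesses — at every tabulated inhabited
# level of `283 + 5¹¹13² = 2⁸3⁸17³` and at Reyssat/13 the (U)-inequality over print's factorwise `Ism` FAILS for every datum, while the
# CONTAINER reading (U) holds there (abc-iut-C-cert-3); the fork exhibit `∃ T` in Mochizuki's own «union of possible images» reading
# (abc-iut cell, crux ThetaPartII = stmt-ABC-19678; row «C:PERIMAGE-PRINT-ISM», part 6)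

Record-only PROOF file (D-0012; no definition, no `Prop` fact) of the abc-iut cell (WAVE-3 discharge seat abc-iut-c312-d1, gen 11; sequel of
`LDHGenuineUnionPrintIsm` (part 5) and `LDHGenuinePerImagePrintIsmFrey283` (part 4, p513749)). TAKES NO SIDE on [IUTchIII] Cor. 3.12.

* **`Frey283.not_union_printInd2`** — at `λ = 283/(2⁸3⁸17³)` (rational `j`), for every prime `l ≥ 5`, every genuine datum `T` and every family `H`
  DOMINATED BY PRINT's (Ind2): `¬ (−|log(q)| ≤ Σ_p ln ν̄_{𝕃_p}(hull of the H-orbit of the (Ind1)-slot UNION of O_𝕃(−P_Θ)) + ((l+5)/4)·log π)`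
  (part 5's `not_union_printInd2_ratPoint` + part 4's `Frey283.twentyfour_le_logQAvoid_pair'`);
* **`Frey283.nonempty_and_not_union_printInd2_tabulated`** — at EVERY one of the 73 tabulated levels `13 ≤ l ≤ 397`: datum type INHABITED
  (abc-iut-C-cert-3 `Conditional.Frey283.nonempty_and_cor312Of_and_cor312PerImageOf_tabulated`, by name) ∧ failure of the (U)-inequality over
  print's `Ism` for every datum and every print-dominated `H` — side by side with the container reading (U) `T.Cor312Of` HOLDING there;
* **`Frey283.exists_containerU_holds_and_unionPrintInd2_fails_thirteen`** — THE FORK EXHIBIT IN READING (U): `∃ T` at (283-triple, `l = 13`) with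
  `T.Cor312Of` (Θ-side = hull of the union of possible images over the Dupuy–Hilado CONTAINER) ∧ failure of the same inequality with the Θ-side
  over PRINT's factorwise `Ism` for every print-dominated `H`;
* `Reyssat.not_union_printInd2`, **`Reyssat.nonempty_and_not_union_printInd2_thirteen`** — the same at `λ = 2/23⁵`, `l = 13`.

READING (numbers about OUR typed objects; the C LEAD's words decide the booking): at these inhabited rational rows Mochizuki's (U)-shaped
inequality — «−|log(q)| ≤ −|log(Θ)|» with `−|log(Θ)|` the log-volume of the holomorphic hull of the UNION of the possible images ([IUTchIII]
Cor. 3.12 p. 174), (Ind1) := Dupuy–Hilado's capsule permutations (§4.7), (Ind3) := upper bound / sharp datum — HOLDS when (Ind2) := the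
Dupuy–Hilado container `Aut_{ℚ_p}(K_v : I_v)` and FAILS when (Ind2) := PRINT's factorwise `Ism` as typed by abc-iut-c312-1 (= `ℤ_p^×·id`,
abc-iut-w5-d216): in kernel, at the same exhibited datum. Which is print's EFFECTIVE (Ind2), and print's (Ind1) STRIP part (abc-iut-c312-1's
R-rows), (Ind3), the log-link, Cor. 3.12 itself, are untouched; refuted-as-typed ≠ refuted in print; no height bound follows; nothing here asserts
that abc is proved or refuted; no side taken. [cite: Mochizuki2012, IUTchIII Cor. 3.12 p. 173–174; Thm. 3.11 (i) p. 154] [cite: Mochizuki2012,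
IUTchIV Thm. 1.10 Step (v) p. 27–28; Cor. 2.2 (ii) proof (P6)(P7) p. 46] [cite: DupuyHilado2025, §4.7, §4.9, §4.11–4.12] [claim: Mochizuki2012,
status: disputed] for every IUT quotation. Axioms: standard three.
-/

noncomputable section

open NumberField IsDedekindDomain

namespace Literature.IUT.LogVolume.Cor22

open Summit.ABC.IUTFork Summit.ABC.IUTFork.Thm311.Real Literature.NumberTheory.NumberFields
open Literature.NumberTheory.DiophantineGeometry Literature.NumberTheory.DiophantineGeometry.GenEll

/-! ## 1. `283 + 5¹¹·13² = 2⁸·3⁸·17³` -/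

namespace Frey283

/-- **At `λ = 283/(2⁸3⁸17³)`, for EVERY prime `l ≥ 5`, every genuine datum `T` and every print-dominated `H`, the (U)-inequality over PRINT's
(Ind2) FAILS** (part 5's `not_union_printInd2_ratPoint`; `log q^{∤{2,l}} ≥ 24` = part 4's `twentyfour_le_logQAvoid_pair'`).
[cite: Mochizuki2012, IUTchIII Cor. 3.12 p. 174; Thm. 3.11 (i) p. 154] [claim: Mochizuki2012, status: disputed] -/
theorem not_union_printInd2 {l : ℕ} (hl : l.Prime) (h5 : 5 ≤ l)
    (T : ThetaVolumeDatumAt (ratPoint (((283 : ℕ) : ℚ) / (8251953408 : ℕ))) l) :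
    letI := T.instFieldF; letI := T.instNumberFieldF; letI := T.instFieldK; letI := T.instNumberFieldK
    letI := T.instAlgebraK; letI := T.instIsElliptic
    ∀ (H : (p : ℕ) → (hp : p.Prime) → (j : ℕ) →
        (e : Fin (j + 1) → placesOver (Literature.IUT.HodgeTheaters.fieldOfModuli T.E) p) →
        haveI : Fact p.Prime := ⟨hp⟩
        Subgroup (PacketAlgebra p (fun b => (T.I.σ.localFields p).k (e b)) ≃ₗ[ℚ_[p]]
          PacketAlgebra p (fun b => (T.I.σ.localFields p).k (e b)))),
      (∀ (p : ℕ) (hp : p.Prime), haveI : Fact p.Prime := ⟨hp⟩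
        ∀ j e, ∀ g ∈ H p hp j e,
          ∃ ψ : ∀ b : Fin (j + 1), Carrier (.inr (T.I.σ.lift (e b).1) : Thm311.Real.Place T.K) ≃ₗ[ℚ]
              Carrier (.inr (T.I.σ.lift (e b).1) : Thm311.Real.Place T.K),
            (∀ b, ψ b ∈ ismIsm (analyticLogv T.K) (T.I.σ.lift (e b).1)) ∧
            ∀ x : ∀ b, (T.I.σ.localFields p).k (e b),
              (g : PacketAlgebra p (fun b => (T.I.σ.localFields p).k (e b)) ≃ₗ[ℚ_[p]]
                  PacketAlgebra p (fun b => (T.I.σ.localFields p).k (e b))) (PiTensorProduct.tprod ℚ_[p] x) =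
                PiTensorProduct.tprod ℚ_[p] (fun b =>
                  RescaledCompletion.of T.K p (T.I.σ.lift (e b).1) (T.I.σ.natCast_mem_lift (e b))
                    (ψ b ((RescaledCompletion.of T.K p (T.I.σ.lift (e b).1) (T.I.σ.natCast_mem_lift (e b))).symm (x b))))) →
      ¬ (T.negAbsLogQ ≤
          (∑ p ∈ T.I.supportPrimes,
            if hp : p.Prime then
              (haveI : Fact p.Prime := ⟨hp⟩
               (T.I.packetAt p hp).lnνLp T.I.lstar (fun j e =>
                 packetHull p (fun b => (T.I.σ.localFields p).k (e b))
                   (⋃ g : H p hp j e, (g : PacketAlgebra p (fun b => (T.I.σ.localFields p).k (e b)) ≃ₗ[ℚ_[p]]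
                       PacketAlgebra p (fun b => (T.I.σ.localFields p).k (e b))) ''
                     ⋃ τ : Equiv.Perm (Fin (j + 1)), (T.I.packetAt p hp).perm τ e ''
                       (T.I.packetAt p hp).pilotRegion (T.I.tΘ p hp) j (e ∘ τ))))
            else 0) + ThetaVolumeInput.archLogTheta l) :=
  T.not_union_printInd2_ratPoint (by norm_num) (by norm_num) h5 (twentyfour_le_logQAvoid_pair' hl h5)

/-- **AT EVERY ONE OF THE 73 TABULATED LEVELS `13 ≤ l ≤ 397` of `283 + 5¹¹13² = 2⁸3⁸17³`: the genuine datum type is INHABITED (abc-iut-C-cert-3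
junction, by name) AND for every datum and every print-dominated `H` the (U)-inequality over PRINT's (Ind2) FAILS** — while the container reading
(U) `T.Cor312Of` HOLDS for every datum there (same junction). [cite: Mochizuki2012, IUTchIII Cor. 3.12 p. 174] [cite: Mochizuki2012, IUTchIV
Cor. 2.2 (ii) proof (P6)(P7) p. 46] [claim: Mochizuki2012, status: disputed] -/
theorem nonempty_and_not_union_printInd2_tabulated :
    ∀ l ∈ ([13, 17, 19, 23, 29, 31, 37, 41, 43, 47, 53, 59, 61, 67, 71, 73, 79, 83, 89, 97, 101, 103, 107, 109, 113, 127, 131,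
      137, 139, 149, 151, 157, 163, 167, 173, 179, 181, 191, 193, 197, 199, 211, 223, 227, 229, 233, 239, 241, 251,
      257, 263, 269, 271, 277, 281, 283, 293, 307, 311, 313, 317, 331, 337, 347, 349, 353, 359, 367, 373, 379, 383,
      389, 397] : List ℕ),
    Nonempty (ThetaVolumeDatumAt (ratPoint (((283 : ℕ) : ℚ) / (8251953408 : ℕ))) l) ∧
    ∀ T : ThetaVolumeDatumAt (ratPoint (((283 : ℕ) : ℚ) / (8251953408 : ℕ))) l,
    letI := T.instFieldF; letI := T.instNumberFieldF; letI := T.instFieldK; letI := T.instNumberFieldK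
    letI := T.instAlgebraK; letI := T.instIsElliptic
    ∀ (H : (p : ℕ) → (hp : p.Prime) → (j : ℕ) →
        (e : Fin (j + 1) → placesOver (Literature.IUT.HodgeTheaters.fieldOfModuli T.E) p) →
        haveI : Fact p.Prime := ⟨hp⟩
        Subgroup (PacketAlgebra p (fun b => (T.I.σ.localFields p).k (e b)) ≃ₗ[ℚ_[p]]
          PacketAlgebra p (fun b => (T.I.σ.localFields p).k (e b)))),
      (∀ (p : ℕ) (hp : p.Prime), haveI : Fact p.Prime := ⟨hp⟩
        ∀ j e, ∀ g ∈ H p hp j e,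
          ∃ ψ : ∀ b : Fin (j + 1), Carrier (.inr (T.I.σ.lift (e b).1) : Thm311.Real.Place T.K) ≃ₗ[ℚ]
              Carrier (.inr (T.I.σ.lift (e b).1) : Thm311.Real.Place T.K),
            (∀ b, ψ b ∈ ismIsm (analyticLogv T.K) (T.I.σ.lift (e b).1)) ∧
            ∀ x : ∀ b, (T.I.σ.localFields p).k (e b),
              (g : PacketAlgebra p (fun b => (T.I.σ.localFields p).k (e b)) ≃ₗ[ℚ_[p]]
                  PacketAlgebra p (fun b => (T.I.σ.localFields p).k (e b))) (PiTensorProduct.tprod ℚ_[p] x) =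
                PiTensorProduct.tprod ℚ_[p] (fun b =>
                  RescaledCompletion.of T.K p (T.I.σ.lift (e b).1) (T.I.σ.natCast_mem_lift (e b))
                    (ψ b ((RescaledCompletion.of T.K p (T.I.σ.lift (e b).1) (T.I.σ.natCast_mem_lift (e b))).symm (x b))))) →
      ¬ (T.negAbsLogQ ≤
          (∑ p ∈ T.I.supportPrimes,
            if hp : p.Prime then
              (haveI : Fact p.Prime := ⟨hp⟩
               (T.I.packetAt p hp).lnνLp T.I.lstar (fun j e =>
                 packetHull p (fun b => (T.I.σ.localFields p).k (e b))
                   (⋃ g : H p hp j e, (g : PacketAlgebra p (fun b => (T.I.σ.localFields p).k (e b)) ≃ₗ[ℚ_[p]]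
                       PacketAlgebra p (fun b => (T.I.σ.localFields p).k (e b))) ''
                     ⋃ τ : Equiv.Perm (Fin (j + 1)), (T.I.packetAt p hp).perm τ e ''
                       (T.I.packetAt p hp).pilotRegion (T.I.tΘ p hp) j (e ∘ τ))))
            else 0) + ThetaVolumeInput.archLogTheta l) := by
  intro l hl
  have hside : ∀ l ∈ ([13, 17, 19, 23, 29, 31, 37, 41, 43, 47, 53, 59, 61, 67, 71, 73, 79, 83, 89, 97, 101, 103, 107, 109, 113, 127, 131,
      137, 139, 149, 151, 157, 163, 167, 173, 179, 181, 191, 193, 197, 199, 211, 223, 227, 229, 233, 239, 241, 251,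
      257, 263, 269, 271, 277, 281, 283, 293, 307, 311, 313, 317, 331, 337, 347, 349, 353, 359, 367, 373, 379, 383,
      389, 397] : List ℕ), l.Prime ∧ 5 ≤ l := by decide +kernel
  exact ⟨(Conditional.Frey283.nonempty_and_cor312Of_and_cor312PerImageOf_tabulated l hl).1,
    fun T => not_union_printInd2 (hside l hl).1 (hside l hl).2 T⟩

/-- **THE FORK EXHIBIT IN MOCHIZUKI's READING (U)** at (283-triple, `l = 13`): `∃ T` with `T.Cor312Of` — the (U)-inequality with Θ-side the hull
of the UNION of possible images over the Dupuy–Hilado CONTAINER (abc-iut-C-cert-3, by name) — AND failure of the same inequality with the Θ-side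
over PRINT's factorwise `Ism` for every print-dominated `H`. [cite: Mochizuki2012, IUTchIII Cor. 3.12 p. 174; Thm. 3.11 (i) p. 154]
[cite: DupuyHilado2025, §4.9, §4.11] [claim: Mochizuki2012, status: disputed] -/
theorem exists_containerU_holds_and_unionPrintInd2_fails_thirteen :
    ∃ T : ThetaVolumeDatumAt (ratPoint (((283 : ℕ) : ℚ) / (8251953408 : ℕ))) 13,
    T.Cor312Of ∧
    letI := T.instFieldF; letI := T.instNumberFieldF; letI := T.instFieldK; letI := T.instNumberFieldK
    letI := T.instAlgebraK; letI := T.instIsElliptic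
    ∀ (H : (p : ℕ) → (hp : p.Prime) → (j : ℕ) →
        (e : Fin (j + 1) → placesOver (Literature.IUT.HodgeTheaters.fieldOfModuli T.E) p) →
        haveI : Fact p.Prime := ⟨hp⟩
        Subgroup (PacketAlgebra p (fun b => (T.I.σ.localFields p).k (e b)) ≃ₗ[ℚ_[p]]
          PacketAlgebra p (fun b => (T.I.σ.localFields p).k (e b)))),
      (∀ (p : ℕ) (hp : p.Prime), haveI : Fact p.Prime := ⟨hp⟩
        ∀ j e, ∀ g ∈ H p hp j e,
          ∃ ψ : ∀ b : Fin (j + 1), Carrier (.inr (T.I.σ.lift (e b).1) : Thm311.Real.Place T.K) ≃ₗ[ℚ]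
              Carrier (.inr (T.I.σ.lift (e b).1) : Thm311.Real.Place T.K),
            (∀ b, ψ b ∈ ismIsm (analyticLogv T.K) (T.I.σ.lift (e b).1)) ∧
            ∀ x : ∀ b, (T.I.σ.localFields p).k (e b),
              (g : PacketAlgebra p (fun b => (T.I.σ.localFields p).k (e b)) ≃ₗ[ℚ_[p]]
                  PacketAlgebra p (fun b => (T.I.σ.localFields p).k (e b))) (PiTensorProduct.tprod ℚ_[p] x) =
                PiTensorProduct.tprod ℚ_[p] (fun b =>
                  RescaledCompletion.of T.K p (T.I.σ.lift (e b).1) (T.I.σ.natCast_mem_lift (e b))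
                    (ψ b ((RescaledCompletion.of T.K p (T.I.σ.lift (e b).1) (T.I.σ.natCast_mem_lift (e b))).symm (x b))))) →
      ¬ (T.negAbsLogQ ≤
          (∑ p ∈ T.I.supportPrimes,
            if hp : p.Prime then
              (haveI : Fact p.Prime := ⟨hp⟩
               (T.I.packetAt p hp).lnνLp T.I.lstar (fun j e =>
                 packetHull p (fun b => (T.I.σ.localFields p).k (e b))
                   (⋃ g : H p hp j e, (g : PacketAlgebra p (fun b => (T.I.σ.localFields p).k (e b)) ≃ₗ[ℚ_[p]]
                       PacketAlgebra p (fun b => (T.I.σ.localFields p).k (e b))) ''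
                     ⋃ τ : Equiv.Perm (Fin (j + 1)), (T.I.packetAt p hp).perm τ e ''
                       (T.I.packetAt p hp).pilotRegion (T.I.tΘ p hp) j (e ∘ τ))))
            else 0) + ThetaVolumeInput.archLogTheta 13) :=
  have h13 : Nat.Prime 13 ∧ 5 ≤ 13 := by norm_num
  (Conditional.Frey283.nonempty_and_cor312Of_and_cor312PerImageOf_tabulated 13 (List.mem_cons_self ..)).elim
    fun hne hUP => hne.elim fun T => ⟨T, (hUP T).1, not_union_printInd2 h13.1 h13.2 T⟩

end Frey283

/-! ## 2. Reyssat `2 + 3¹⁰·109 = 23⁵` -/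

namespace Reyssat

/-- **At `λ = 2/23⁵`, for every prime `l ≥ 5` off `{3, 23, 109}`, every genuine datum `T` and every print-dominated `H`: the (U)-inequality over
PRINT's (Ind2) FAILS.** [cite: Mochizuki2012, IUTchIII Cor. 3.12 p. 174; Thm. 3.11 (i) p. 154] [claim: Mochizuki2012, status: disputed] -/
theorem not_union_printInd2 {l : ℕ} (hl : l.Prime) (h5 : 5 ≤ l) (hlI : l ∉ ({3, 23, 109} : Finset ℕ))
    (T : ThetaVolumeDatumAt (ratPoint (((2 : ℕ) : ℚ) / (6436343 : ℕ))) l) :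
    letI := T.instFieldF; letI := T.instNumberFieldF; letI := T.instFieldK; letI := T.instNumberFieldK
    letI := T.instAlgebraK; letI := T.instIsElliptic
    ∀ (H : (p : ℕ) → (hp : p.Prime) → (j : ℕ) →
        (e : Fin (j + 1) → placesOver (Literature.IUT.HodgeTheaters.fieldOfModuli T.E) p) →
        haveI : Fact p.Prime := ⟨hp⟩
        Subgroup (PacketAlgebra p (fun b => (T.I.σ.localFields p).k (e b)) ≃ₗ[ℚ_[p]]
          PacketAlgebra p (fun b => (T.I.σ.localFields p).k (e b)))),
      (∀ (p : ℕ) (hp : p.Prime), haveI : Fact p.Prime := ⟨hp⟩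
        ∀ j e, ∀ g ∈ H p hp j e,
          ∃ ψ : ∀ b : Fin (j + 1), Carrier (.inr (T.I.σ.lift (e b).1) : Thm311.Real.Place T.K) ≃ₗ[ℚ]
              Carrier (.inr (T.I.σ.lift (e b).1) : Thm311.Real.Place T.K),
            (∀ b, ψ b ∈ ismIsm (analyticLogv T.K) (T.I.σ.lift (e b).1)) ∧
            ∀ x : ∀ b, (T.I.σ.localFields p).k (e b),
              (g : PacketAlgebra p (fun b => (T.I.σ.localFields p).k (e b)) ≃ₗ[ℚ_[p]]
                  PacketAlgebra p (fun b => (T.I.σ.localFields p).k (e b))) (PiTensorProduct.tprod ℚ_[p] x) =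
                PiTensorProduct.tprod ℚ_[p] (fun b =>
                  RescaledCompletion.of T.K p (T.I.σ.lift (e b).1) (T.I.σ.natCast_mem_lift (e b))
                    (ψ b ((RescaledCompletion.of T.K p (T.I.σ.lift (e b).1) (T.I.σ.natCast_mem_lift (e b))).symm (x b))))) →
      ¬ (T.negAbsLogQ ≤
          (∑ p ∈ T.I.supportPrimes,
            if hp : p.Prime then
              (haveI : Fact p.Prime := ⟨hp⟩
               (T.I.packetAt p hp).lnνLp T.I.lstar (fun j e =>
                 packetHull p (fun b => (T.I.σ.localFields p).k (e b))
                   (⋃ g : H p hp j e, (g : PacketAlgebra p (fun b => (T.I.σ.localFields p).k (e b)) ≃ₗ[ℚ_[p]]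
                       PacketAlgebra p (fun b => (T.I.σ.localFields p).k (e b))) ''
                     ⋃ τ : Equiv.Perm (Fin (j + 1)), (T.I.packetAt p hp).perm τ e ''
                       (T.I.packetAt p hp).pilotRegion (T.I.tΘ p hp) j (e ∘ τ))))
            else 0) + ThetaVolumeInput.archLogTheta l) :=
  T.not_union_printInd2_ratPoint (by norm_num) (by norm_num) h5 (twentyfour_le_logQAvoid_pair' hl hlI)

/-- **REYSSAT AT `l = 13`: datum type INHABITED (abc-iut-C-cert-3 junction) ∧ the (U)-inequality over PRINT's (Ind2) FAILS for every datum and every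
print-dominated `H`** — while the container readings hold there. [cite: Mochizuki2012, IUTchIII Cor. 3.12 p. 174] [cite: Mochizuki2012, IUTchIV
Cor. 2.2 (ii) proof (P6)(P7) p. 46] [claim: Mochizuki2012, status: disputed] -/
theorem nonempty_and_not_union_printInd2_thirteen :
    Nonempty (ThetaVolumeDatumAt (ratPoint (((2 : ℕ) : ℚ) / (6436343 : ℕ))) 13) ∧
    ∀ T : ThetaVolumeDatumAt (ratPoint (((2 : ℕ) : ℚ) / (6436343 : ℕ))) 13,
    letI := T.instFieldF; letI := T.instNumberFieldF; letI := T.instFieldK; letI := T.instNumberFieldK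
    letI := T.instAlgebraK; letI := T.instIsElliptic
    ∀ (H : (p : ℕ) → (hp : p.Prime) → (j : ℕ) →
        (e : Fin (j + 1) → placesOver (Literature.IUT.HodgeTheaters.fieldOfModuli T.E) p) →
        haveI : Fact p.Prime := ⟨hp⟩
        Subgroup (PacketAlgebra p (fun b => (T.I.σ.localFields p).k (e b)) ≃ₗ[ℚ_[p]]
          PacketAlgebra p (fun b => (T.I.σ.localFields p).k (e b)))),
      (∀ (p : ℕ) (hp : p.Prime), haveI : Fact p.Prime := ⟨hp⟩
        ∀ j e, ∀ g ∈ H p hp j e,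
          ∃ ψ : ∀ b : Fin (j + 1), Carrier (.inr (T.I.σ.lift (e b).1) : Thm311.Real.Place T.K) ≃ₗ[ℚ]
              Carrier (.inr (T.I.σ.lift (e b).1) : Thm311.Real.Place T.K),
            (∀ b, ψ b ∈ ismIsm (analyticLogv T.K) (T.I.σ.lift (e b).1)) ∧
            ∀ x : ∀ b, (T.I.σ.localFields p).k (e b),
              (g : PacketAlgebra p (fun b => (T.I.σ.localFields p).k (e b)) ≃ₗ[ℚ_[p]]
                  PacketAlgebra p (fun b => (T.I.σ.localFields p).k (e b))) (PiTensorProduct.tprod ℚ_[p] x) =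
                PiTensorProduct.tprod ℚ_[p] (fun b =>
                  RescaledCompletion.of T.K p (T.I.σ.lift (e b).1) (T.I.σ.natCast_mem_lift (e b))
                    (ψ b ((RescaledCompletion.of T.K p (T.I.σ.lift (e b).1) (T.I.σ.natCast_mem_lift (e b))).symm (x b))))) →
      ¬ (T.negAbsLogQ ≤
          (∑ p ∈ T.I.supportPrimes,
            if hp : p.Prime then
              (haveI : Fact p.Prime := ⟨hp⟩
               (T.I.packetAt p hp).lnνLp T.I.lstar (fun j e =>
                 packetHull p (fun b => (T.I.σ.localFields p).k (e b))
                   (⋃ g : H p hp j e, (g : PacketAlgebra p (fun b => (T.I.σ.localFields p).k (e b)) ≃ₗ[ℚ_[p]]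
                       PacketAlgebra p (fun b => (T.I.σ.localFields p).k (e b))) ''
                     ⋃ τ : Equiv.Perm (Fin (j + 1)), (T.I.packetAt p hp).perm τ e ''
                       (T.I.packetAt p hp).pilotRegion (T.I.tΘ p hp) j (e ∘ τ))))
            else 0) + ThetaVolumeInput.archLogTheta 13) :=
  ⟨(nonempty_and_not_perImage_printInd2_thirteen).1, fun T => not_union_printInd2 (by norm_num) (by norm_num) (by decide) T⟩

end Reyssat

end Literature.IUT.LogVolume.Cor22

end
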